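import Summits.QuantumFields.BalabanUV.Beta.FP.NestedStepLawSliced

/-!
# `BalabanUV.Beta.FP.KKTCornerReduction` — road «FP» for binder row D1, R-FP-51 row **(T-INST-j)** (owner, gen 16), first piece: THE BLOCK SYSTEM OF
# `NestedStepLawSliced` ON `μ ⊕ ρ₁` WITH THE `ρ₁`-KILLING CONSTRAINT ROW IS THE CORNER SYSTEM ON `μ` —
# `det kkt E [[P,0],[0,1]] = (−1)^{|ρ|}·det kkt E₁₁ P` for EVERY `E` (the `ρ`-rows and -columns of `E` drop out), hence equal `secondVar`s along any `C²` curves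

HONEST DEPENDENCY (page 1, mandatory): continuum YM on T⁴ ⇐ BetaPertH ∧ nine spine estimates (0/9 proved); BetaPertH ⇐ (D1) ∧ (D4) ∧ CAP+tail;
G-an2-4 gates asym, D1 and NE2/3/4.  HONEST FRAMING (cell contract, verbatim): «discharging `BetaPertH` makes Bałaban's UV stability UNCONDITIONAL —
a real constructive-QFT result; it is NOT the continuum limit and NOT the Clay problem.»  THIS MODULE is [folklore] block-determinant algebra (pattern of an5's
`CompositionSingular.regroup ∕ det_unint'`) + road BF-x's `secondVar_comb_eq_zero`; no `def … : Prop`, nothing cited, 0 sorry (two bookkeeping `def`s: a regrouping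
`Equiv` and the regrouped block matrix, asserting nothing); 0∕4 row-D1 binders; NOT (T-INST-j) itself, NOT SDF, NOT D1, NOT BetaPertH, NOT continuum, NOT Clay.

ABSOLUTE RULE (cell charter, verbatim): «No internally-minted statement may enter as a cited fact. Every hypothesis is either kernel-proved in this package or a
verbatim quotation of a PUBLISHED theorem with page reference. The manuscript(s) under audit are NOT citable for their own disputed steps — they are the thing
under adjudication; programme-internal (2001/route/tribunal) claims are never citable.»

WHY.  `NestedStepLawSliced.secondVar_nestedStepLaw_sliced` (p303855 ✓) delivers the block factor as `kkt (effForm H [Q₁;τ₁] + (G ⊕ 0)) P̃` on `μ ⊕ ρ₁` with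
`P̃ = [[Q₂,0],[τ₂,0],[0,1]]`: the last constraint row kills the fine-slice multipliers `ρ₁`.  ROUTE T's (T-ID) must identify that factor with the (j+1, m) system
`kkt (seff_{j+1} + …) [Q₂;τ₂]` on `μ`.  This file proves the identification at determinant and second-variation level: killing variables by a constraint row is the same
as deleting them.  Proof: regroup `(μ ⊕ ρ) ⊕ (κ ⊕ ρ) ≃ (μ ⊕ κ) ⊕ (ρ ⊕ ρ)`; the regrouped matrix is `[[kkt E₁₁ P, B],[C, D]]` with `D = [[E₂₂, 1],[1, 0]]` unimodular
(`det = (−1)^{|ρ|}`) and Schur complement `kkt E₁₁ P − B·D⁻¹·C = kkt E₁₁ P` EXACTLY (`B·D⁻¹·C = 0`).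

CONTENTS: `cornerRegroup` (the `Equiv`), `cornerMid E₂₂ := [[E₂₂,1],[1,0]]`, `cornerMidInv`, `det_blockSwap`, `det_cornerMid`, `kkt_killRows_eq_submatrix`, **`det_kkt_killRows`**
(`det kkt E (fromBlocks P 0 0 1) = (−1)^{|ρ|} · det kkt E.toBlocks₁₁ P`), `hasDerivAt_cornerConstraint` (`u ↦ [[P(u),0],[0,D]]`), `hasDerivAt_corner₁₁` (the `₁₁` corner of a
matrix curve), **`secondVar_kkt_killRows`** (for `C²` curves `E`, `P` with the corner system non-degenerate at `0`: `secondVar` of `kkt E [[P,0],[0,1]]` = `secondVar` of `kkt E₁₁ P`).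
Provenance: road FP OWNER b2b-balaban-beta-d1-p3 gen 16 (prover-b2b-balaban-beta-d1-p3-g16-0), 2026-08-21; R-FP-51 row (T-INST-j).
-/

noncomputable section

namespace Summit.QuantumFields.BalabanUV.Beta.FP.KKTCornerReduction

open Matrix Filter Finset
open scoped Topology
open Literature.MathematicalPhysics.QuantumFieldTheory.Balaban1983to89.Beta.Composition (kkt)
open Literature.Analysis.Calculus (eventually_det_ne_zero)
open Summit.QuantumFields.BalabanUV.Beta.D1BFx.LogDetSecondVariation (secondVar secondVar_comb_eq_zero)
open Summit.QuantumFields.BalabanUV.Beta.D1BFx.SliceTransferModel (hasDerivAt_kkt hasDerivAt_entry)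

/-! ## §1 Block algebra: the constraint row that kills variables -/

section Blocks

variable {𝕜 : Type*} [Field 𝕜]
variable {μ κ ρ : Type*} [Fintype μ] [Fintype κ] [Fintype ρ] [DecidableEq μ] [DecidableEq κ] [DecidableEq ρ]

/-- [bookkeeping] The regrouping `(μ ⊕ ρ) ⊕ (κ ⊕ ρ) ≃ (μ ⊕ κ) ⊕ (ρ ⊕ ρ)` (variables `μ`, killed variables `ρ`; constraints `κ`, killing rows `ρ`) ↦
((variables, constraints), (killed variables, killing rows)). -/
def cornerRegroup (μ κ ρ : Type*) : (μ ⊕ ρ) ⊕ (κ ⊕ ρ) ≃ (μ ⊕ κ) ⊕ (ρ ⊕ ρ) where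
  toFun
    | Sum.inl (Sum.inl x) => Sum.inl (Sum.inl x)
    | Sum.inl (Sum.inr r) => Sum.inr (Sum.inl r)
    | Sum.inr (Sum.inl k) => Sum.inl (Sum.inr k)
    | Sum.inr (Sum.inr r) => Sum.inr (Sum.inr r)
  invFun
    | Sum.inl (Sum.inl x) => Sum.inl (Sum.inl x)
    | Sum.inl (Sum.inr k) => Sum.inr (Sum.inl k)
    | Sum.inr (Sum.inl r) => Sum.inl (Sum.inr r)
    | Sum.inr (Sum.inr r) => Sum.inr (Sum.inr r)
  left_inv := by rintro ((x | r) | (k | r)) <;> rfl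
  right_inv := by rintro ((x | k) | (r | r)) <;> rfl

/-- [bookkeeping] The (killed variables, killing rows) block `[[E₂₂, 1],[1, 0]]`. -/
def cornerMid (E₂₂ : Matrix ρ ρ 𝕜) : Matrix (ρ ⊕ ρ) (ρ ⊕ ρ) 𝕜 := fromBlocks E₂₂ 1 1 0

/-- [bookkeeping] Its inverse `[[0, 1],[1, −E₂₂]]`. -/
def cornerMidInv (E₂₂ : Matrix ρ ρ 𝕜) : Matrix (ρ ⊕ ρ) (ρ ⊕ ρ) 𝕜 := fromBlocks 0 1 1 (-E₂₂)

omit [Fintype μ] [Fintype κ] [DecidableEq μ] [DecidableEq κ] in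
/-- [folklore] `cornerMid · cornerMidInv = 1`. -/
theorem cornerMid_mul_cornerMidInv (E₂₂ : Matrix ρ ρ 𝕜) : cornerMid E₂₂ * cornerMidInv E₂₂ = 1 := by
  unfold cornerMid cornerMidInv
  rw [fromBlocks_multiply, ← fromBlocks_one]
  simp

omit [Fintype μ] [Fintype κ] [DecidableEq μ] [DecidableEq κ] in
/-- [folklore] `cornerMidInv · cornerMid = 1`. -/
theorem cornerMidInv_mul_cornerMid (E₂₂ : Matrix ρ ρ 𝕜) : cornerMidInv E₂₂ * cornerMid E₂₂ = 1 := by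
  unfold cornerMid cornerMidInv
  rw [fromBlocks_multiply, ← fromBlocks_one]
  simp

/-- [folklore] The middle block is invertible. -/
@[reducible] def cornerMidInvertible (E₂₂ : Matrix ρ ρ 𝕜) : Invertible (cornerMid E₂₂) :=
  ⟨cornerMidInv E₂₂, cornerMidInv_mul_cornerMid E₂₂, cornerMid_mul_cornerMidInv E₂₂⟩

omit [Fintype μ] [Fintype κ] [DecidableEq μ] [DecidableEq κ] in
omit [Fintype μ] [Fintype κ] [DecidableEq μ] [DecidableEq κ] in
/-- [folklore] `det [[0, 1],[1, 0]] = (−1)^{|ρ|}` (the block swap), from the LU-type factorisation `[[1,1],[0,1]]·[[−1,0],[1,1]]·[[1,−1],[0,1]]`. -/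
theorem det_blockSwap : (fromBlocks (0 : Matrix ρ ρ 𝕜) (1 : Matrix ρ ρ 𝕜) (1 : Matrix ρ ρ 𝕜) (0 : Matrix ρ ρ 𝕜)).det = (-1) ^ Fintype.card ρ := by
  have h3 : fromBlocks (0 : Matrix ρ ρ 𝕜) (1 : Matrix ρ ρ 𝕜) (1 : Matrix ρ ρ 𝕜) (0 : Matrix ρ ρ 𝕜)
      = fromBlocks (1 : Matrix ρ ρ 𝕜) (1 : Matrix ρ ρ 𝕜) (0 : Matrix ρ ρ 𝕜) (1 : Matrix ρ ρ 𝕜)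
        * (fromBlocks (-1 : Matrix ρ ρ 𝕜) (0 : Matrix ρ ρ 𝕜) (1 : Matrix ρ ρ 𝕜) (1 : Matrix ρ ρ 𝕜)
        * fromBlocks (1 : Matrix ρ ρ 𝕜) (-1 : Matrix ρ ρ 𝕜) (0 : Matrix ρ ρ 𝕜) (1 : Matrix ρ ρ 𝕜)) := by
    rw [fromBlocks_multiply, fromBlocks_multiply]
    simp
  rw [h3, det_mul, det_mul, det_fromBlocks_zero₂₁, det_fromBlocks_zero₁₂, det_fromBlocks_zero₂₁]
  simp [Matrix.det_neg]

omit [Fintype μ] [Fintype κ] [DecidableEq μ] [DecidableEq κ] in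
/-- [folklore] **`det [[E₂₂, 1],[1, 0]] = (−1)^{|ρ|}`** — unimodular whatever `E₂₂` is (`[[E₂₂,1],[1,0]] = [[1,E₂₂],[0,1]]·[[0,1],[1,0]]`). -/
theorem det_cornerMid (E₂₂ : Matrix ρ ρ 𝕜) : (cornerMid E₂₂).det = (-1) ^ Fintype.card ρ := by
  have h : cornerMid E₂₂ = fromBlocks (1 : Matrix ρ ρ 𝕜) E₂₂ (0 : Matrix ρ ρ 𝕜) (1 : Matrix ρ ρ 𝕜)
      * fromBlocks (0 : Matrix ρ ρ 𝕜) (1 : Matrix ρ ρ 𝕜) (1 : Matrix ρ ρ 𝕜) (0 : Matrix ρ ρ 𝕜) := by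
    rw [cornerMid, fromBlocks_multiply]
    simp
  rw [h, det_mul, det_fromBlocks_zero₂₁, det_blockSwap]
  simp

omit [Fintype μ] [Fintype κ] [Fintype ρ] [DecidableEq μ] [DecidableEq κ] in
/-- [folklore] **THE KKT MATRIX WITH A VARIABLE-KILLING ROW, REGROUPED**: `kkt E [[P,0],[0,1]]` on `(μ ⊕ ρ) ⊕ (κ ⊕ ρ)` is, up to `cornerRegroup`,
`[[kkt E₁₁ P, [[E₁₂,0],[0,0]]],[[[E₂₁,0],[0,0]], [[E₂₂,1],[1,0]]]]`. -/
theorem kkt_killRows_eq_submatrix (E : Matrix (μ ⊕ ρ) (μ ⊕ ρ) 𝕜) (P : Matrix κ μ 𝕜) :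
    kkt E (fromBlocks P (0 : Matrix κ ρ 𝕜) (0 : Matrix ρ μ 𝕜) (1 : Matrix ρ ρ 𝕜)) =
      (fromBlocks (kkt E.toBlocks₁₁ P) (fromBlocks E.toBlocks₁₂ (0 : Matrix μ ρ 𝕜) (0 : Matrix κ ρ 𝕜) (0 : Matrix κ ρ 𝕜))
        (fromBlocks E.toBlocks₂₁ (0 : Matrix ρ κ 𝕜) (0 : Matrix ρ μ 𝕜) (0 : Matrix ρ κ 𝕜)) (cornerMid E.toBlocks₂₂)).submatrix
        (cornerRegroup μ κ ρ) (cornerRegroup μ κ ρ) := by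
  ext i j
  rcases i with ((x | r) | (k | r)) <;> rcases j with ((x' | r') | (k' | r')) <;>
    simp [kkt, cornerRegroup, cornerMid, Matrix.fromBlocks, Matrix.toBlocks₁₁, Matrix.toBlocks₁₂, Matrix.toBlocks₂₁, Matrix.toBlocks₂₂,
      Matrix.one_apply]
  split_ifs <;> simp_all

/-- [folklore] **KILLING VARIABLES BY A CONSTRAINT ROW = DELETING THEM, at determinant level**: `det kkt E [[P,0],[0,1]] = (−1)^{|ρ|} · det kkt E₁₁ P`. -/
theorem det_kkt_killRows (E : Matrix (μ ⊕ ρ) (μ ⊕ ρ) 𝕜) (P : Matrix κ μ 𝕜) :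
    (kkt E (fromBlocks P (0 : Matrix κ ρ 𝕜) (0 : Matrix ρ μ 𝕜) (1 : Matrix ρ ρ 𝕜))).det = (-1) ^ Fintype.card ρ * (kkt E.toBlocks₁₁ P).det := by
  letI : Invertible (cornerMid E.toBlocks₂₂) := cornerMidInvertible E.toBlocks₂₂
  have hz : fromBlocks E.toBlocks₁₂ (0 : Matrix μ ρ 𝕜) (0 : Matrix κ ρ 𝕜) (0 : Matrix κ ρ 𝕜) * cornerMidInv E.toBlocks₂₂
      * fromBlocks E.toBlocks₂₁ (0 : Matrix ρ κ 𝕜) (0 : Matrix ρ μ 𝕜) (0 : Matrix ρ κ 𝕜) = 0 := by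
    unfold cornerMidInv
    rw [fromBlocks_multiply, fromBlocks_multiply, ← fromBlocks_zero]
    simp
  have h1 : (kkt E (fromBlocks P (0 : Matrix κ ρ 𝕜) (0 : Matrix ρ μ 𝕜) (1 : Matrix ρ ρ 𝕜))).det =
      (fromBlocks (kkt E.toBlocks₁₁ P) (fromBlocks E.toBlocks₁₂ (0 : Matrix μ ρ 𝕜) (0 : Matrix κ ρ 𝕜) (0 : Matrix κ ρ 𝕜))
        (fromBlocks E.toBlocks₂₁ (0 : Matrix ρ κ 𝕜) (0 : Matrix ρ μ 𝕜) (0 : Matrix ρ κ 𝕜)) (cornerMid E.toBlocks₂₂)).det := by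
    rw [kkt_killRows_eq_submatrix E P, Matrix.det_submatrix_equiv_self]
  have hinv : ⅟(cornerMid E.toBlocks₂₂) = cornerMidInv E.toBlocks₂₂ := rfl
  rw [h1, Matrix.det_fromBlocks₂₂, hinv, hz, sub_zero, det_cornerMid]

end Blocks

/-! ## §2 Calculus: the two curves and the equality of second variations -/

section SecondVar

variable {μ κ ρ : Type*} [Fintype μ] [Fintype κ] [Fintype ρ] [DecidableEq μ] [DecidableEq κ] [DecidableEq ρ]

omit [Fintype κ] [DecidableEq μ] [DecidableEq κ] [DecidableEq ρ] in
/-- [folklore] `u ↦ [[P(u),0],[0,D]]` has derivative `[[Ṗ,0],[0,0]]`. -/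
theorem hasDerivAt_cornerConstraint {P : ℝ → κ → μ → ℝ} {P' : Matrix κ μ ℝ} {t : ℝ} (D : Matrix ρ ρ ℝ) (hP : HasDerivAt P (Matrix.of.symm P') t) :
    HasDerivAt (fun u => Matrix.of.symm (fromBlocks (Matrix.of (P u)) (0 : Matrix κ ρ ℝ) (0 : Matrix ρ μ ℝ) D))
      (Matrix.of.symm (fromBlocks P' (0 : Matrix κ ρ ℝ) (0 : Matrix ρ μ ℝ) (0 : Matrix ρ ρ ℝ))) t := by
  refine hasDerivAt_pi.2 fun a => hasDerivAt_pi.2 fun b => ?_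
  rcases a with k | r <;> rcases b with m | r'
  · simp only [Matrix.of_symm_apply, Matrix.fromBlocks_apply₁₁, Matrix.of_apply]
    exact hasDerivAt_entry hP k m
  · simp only [Matrix.of_symm_apply, Matrix.fromBlocks_apply₁₂, Matrix.zero_apply]
    exact hasDerivAt_const _ _
  · simp only [Matrix.of_symm_apply, Matrix.fromBlocks_apply₂₁, Matrix.zero_apply]
    exact hasDerivAt_const _ _
  · simp only [Matrix.of_symm_apply, Matrix.fromBlocks_apply₂₂]
    exact hasDerivAt_const _ _

omit [Fintype κ] [DecidableEq μ] [DecidableEq κ] [DecidableEq ρ] in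
/-- [folklore] The `₁₁` corner of a differentiable matrix curve on `μ ⊕ ρ`. -/
theorem hasDerivAt_corner₁₁ {E : ℝ → (μ ⊕ ρ) → (μ ⊕ ρ) → ℝ} {E' : Matrix (μ ⊕ ρ) (μ ⊕ ρ) ℝ} {t : ℝ} (hE : HasDerivAt E (Matrix.of.symm E') t) :
    HasDerivAt (fun u => Matrix.of.symm (Matrix.of (E u)).toBlocks₁₁) (Matrix.of.symm E'.toBlocks₁₁) t :=
  hasDerivAt_pi.2 fun i => hasDerivAt_pi.2 fun j => hasDerivAt_entry hE (Sum.inl i) (Sum.inl j)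

/-- [folklore] **KILLING VARIABLES BY A CONSTRAINT ROW = DELETING THEM, at second-variation level.**  For `C²` curves `E` (on `μ ⊕ ρ`) and `P`, with the CORNER
system `kkt E(0)₁₁ P(0)` non-degenerate: the `secondVar` of `u ↦ kkt E(u) [[P(u),0],[0,1]]` (jets `kkt Ė [[Ṗ,0],[0,0]]`, `kkt Ë [[P̈,0],[0,0]]`) EQUALS the `secondVar` of
`u ↦ kkt E(u)₁₁ P(u)` (jets `kkt Ė₁₁ Ṗ`, `kkt Ë₁₁ P̈`). -/
theorem secondVar_kkt_killRows {E E₁ : ℝ → (μ ⊕ ρ) → (μ ⊕ ρ) → ℝ} {E₂ : Matrix (μ ⊕ ρ) (μ ⊕ ρ) ℝ} {P P₁ : ℝ → κ → μ → ℝ} {P₂ : Matrix κ μ ℝ}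
    (hE : ∀ᶠ u in 𝓝 (0 : ℝ), HasDerivAt E (E₁ u) u) (hE₁ : HasDerivAt E₁ (Matrix.of.symm E₂) 0)
    (hP : ∀ᶠ u in 𝓝 (0 : ℝ), HasDerivAt P (P₁ u) u) (hP₁ : HasDerivAt P₁ (Matrix.of.symm P₂) 0)
    (h0 : (kkt (Matrix.of (E 0)).toBlocks₁₁ (Matrix.of (P 0))).det ≠ 0) :
    secondVar (kkt (Matrix.of (E 0)) (fromBlocks (Matrix.of (P 0)) (0 : Matrix κ ρ ℝ) (0 : Matrix ρ μ ℝ) (1 : Matrix ρ ρ ℝ)))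
        (kkt (Matrix.of (E₁ 0)) (fromBlocks (Matrix.of (P₁ 0)) (0 : Matrix κ ρ ℝ) (0 : Matrix ρ μ ℝ) (0 : Matrix ρ ρ ℝ)))
        (kkt E₂ (fromBlocks P₂ (0 : Matrix κ ρ ℝ) (0 : Matrix ρ μ ℝ) (0 : Matrix ρ ρ ℝ)))
      = secondVar (kkt (Matrix.of (E 0)).toBlocks₁₁ (Matrix.of (P 0))) (kkt (Matrix.of (E₁ 0)).toBlocks₁₁ (Matrix.of (P₁ 0))) (kkt E₂.toBlocks₁₁ P₂) := by
  have hE' : ∀ᶠ u in 𝓝 (0 : ℝ), HasDerivAt E (Matrix.of.symm (Matrix.of (E₁ u))) u := hE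
  have hP' : ∀ᶠ u in 𝓝 (0 : ℝ), HasDerivAt P (Matrix.of.symm (Matrix.of (P₁ u))) u := hP
  -- (K) the killed-row curve and its jets
  have hKd : ∀ᶠ u in 𝓝 (0 : ℝ), HasDerivAt
      (fun u => Matrix.of.symm (kkt (Matrix.of (E u)) (fromBlocks (Matrix.of (P u)) (0 : Matrix κ ρ ℝ) (0 : Matrix ρ μ ℝ) (1 : Matrix ρ ρ ℝ))))
      ((fun u => Matrix.of.symm (kkt (Matrix.of (E₁ u)) (fromBlocks (Matrix.of (P₁ u)) (0 : Matrix κ ρ ℝ) (0 : Matrix ρ μ ℝ) (0 : Matrix ρ ρ ℝ)))) u) u := by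
    filter_upwards [hE', hP'] with u hu hv
    exact hasDerivAt_kkt hu (hasDerivAt_cornerConstraint (1 : Matrix ρ ρ ℝ) hv)
  have hK₁d : HasDerivAt
      (fun u => Matrix.of.symm (kkt (Matrix.of (E₁ u)) (fromBlocks (Matrix.of (P₁ u)) (0 : Matrix κ ρ ℝ) (0 : Matrix ρ μ ℝ) (0 : Matrix ρ ρ ℝ))))
      (Matrix.of.symm (kkt E₂ (fromBlocks P₂ (0 : Matrix κ ρ ℝ) (0 : Matrix ρ μ ℝ) (0 : Matrix ρ ρ ℝ)))) 0 :=
    hasDerivAt_kkt hE₁ (hasDerivAt_cornerConstraint (0 : Matrix ρ ρ ℝ) hP₁)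
  -- (C) the corner curve and its jets
  have hCd : ∀ᶠ u in 𝓝 (0 : ℝ), HasDerivAt (fun u => Matrix.of.symm (kkt (Matrix.of (E u)).toBlocks₁₁ (Matrix.of (P u))))
      ((fun u => Matrix.of.symm (kkt (Matrix.of (E₁ u)).toBlocks₁₁ (Matrix.of (P₁ u)))) u) u := by
    filter_upwards [hE', hP'] with u hu hv
    exact hasDerivAt_kkt (hasDerivAt_corner₁₁ hu) hv
  have hC₁d : HasDerivAt (fun u => Matrix.of.symm (kkt (Matrix.of (E₁ u)).toBlocks₁₁ (Matrix.of (P₁ u)))) (Matrix.of.symm (kkt E₂.toBlocks₁₁ P₂)) 0 :=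
    hasDerivAt_kkt (hasDerivAt_corner₁₁ hE₁) hP₁
  -- non-degeneracy of the killed-row system at `0`
  have hK0 : (kkt (Matrix.of (E 0)) (fromBlocks (Matrix.of (P 0)) (0 : Matrix κ ρ ℝ) (0 : Matrix ρ μ ℝ) (1 : Matrix ρ ρ ℝ))).det ≠ 0 := by
    rw [det_kkt_killRows]
    exact mul_ne_zero (pow_ne_zero _ (neg_ne_zero.mpr one_ne_zero)) h0
  -- the `log|det|` identity holds everywhere with constant `log|(-1)^{|ρ|}| = 0`
  have heq : ∀ᶠ u in 𝓝 (0 : ℝ),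
      (1 : ℝ) * Real.log |(Matrix.of (Matrix.of.symm (kkt (Matrix.of (E u))
          (fromBlocks (Matrix.of (P u)) (0 : Matrix κ ρ ℝ) (0 : Matrix ρ μ ℝ) (1 : Matrix ρ ρ ℝ))))).det|
        + (-1) * Real.log |(Matrix.of (Matrix.of.symm (kkt (Matrix.of (E u)).toBlocks₁₁ (Matrix.of (P u))))).det|
        + 0 * Real.log |(Matrix.of (Matrix.of.symm (kkt (Matrix.of (E u)).toBlocks₁₁ (Matrix.of (P u))))).det|
        + 0 * Real.log |(Matrix.of (Matrix.of.symm (kkt (Matrix.of (E u)).toBlocks₁₁ (Matrix.of (P u))))).det| = 0 := by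
    refine Eventually.of_forall fun u => ?_
    simp only [Equiv.apply_symm_apply, one_mul, neg_one_mul, zero_mul, add_zero]
    rw [det_kkt_killRows, abs_mul, abs_pow, abs_neg, abs_one, one_pow, one_mul]
    ring
  have h := secondVar_comb_eq_zero (a := 1) (b := -1) (c := 0) (d := 0) (k := 0) (t := 0)
    hKd hK₁d hK0 hCd hC₁d h0 hCd hC₁d h0 hCd hC₁d h0 heq
  simp only [one_mul, neg_one_mul, zero_mul, add_zero, Equiv.apply_symm_apply] at h
  have h' : secondVar (kkt (Matrix.of (E 0)) (fromBlocks (Matrix.of (P 0)) (0 : Matrix κ ρ ℝ) (0 : Matrix ρ μ ℝ) (1 : Matrix ρ ρ ℝ)))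
        (kkt (Matrix.of (E₁ 0)) (fromBlocks (Matrix.of (P₁ 0)) (0 : Matrix κ ρ ℝ) (0 : Matrix ρ μ ℝ) (0 : Matrix ρ ρ ℝ)))
        (kkt E₂ (fromBlocks P₂ (0 : Matrix κ ρ ℝ) (0 : Matrix ρ μ ℝ) (0 : Matrix ρ ρ ℝ)))
      + -secondVar (kkt (Matrix.of (E 0)).toBlocks₁₁ (Matrix.of (P 0))) (kkt (Matrix.of (E₁ 0)).toBlocks₁₁ (Matrix.of (P₁ 0))) (kkt E₂.toBlocks₁₁ P₂) = 0 := by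
    exact h
  linarith

end SecondVar

end Summit.QuantumFields.BalabanUV.Beta.FP.KKTCornerReduction

end
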